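/-
Origin: expansion seat `planner-pub-hodgecm-pv13-g6-0`, handover #1c 2026-08-18T15:16Z (md5 3881e9434f7ccd20509b7e31c7e4bfd8, 374 l., 18 decls; part III, KEEPS the module name of the superseded row #1; ONE import rewrite `import Pv13g6.GenuineSchrodingerHeisModulate` ↦ `import HodgeCM.PerL34.GenuineSchrodingerHeisModulate`; land AFTER #1b) (`HOME/pub-hodgecm-pv13-g6/lean/Pv13g6/GenuineSchrodingerHeisSmooth.lean`, md5 3881e943, 374 lines);
landed by the gen-8 packager in gate run 31 as `HodgeCM/PerL34/GenuineSchrodingerHeisSmooth.lean` (import ^import Pv13g6\.GenuineSchrodingerHeisModulate[ \t]*$→import HodgeCM.PerL34.GenuineSchrodingerHeisModulate ×1).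
-/
/-
Copyright (c) 2026. All rights reserved.
Released under Apache 2.0 license as described in the file LICENSE.
Authors: unit pub-hodgecm-pv13-g6 (DAG-NODE PROVER #13 gen 6, seam S3, 𝓕-side).

# HodgeCM/PerL34/GenuineSchrodingerHeisSmooth.lean — `𝒮(X)` = the SMOOTH VECTORS of the adelic
# Heisenberg–Schrödinger representation on `L²(X)` (order-0 data): level stabilisers, the spherical vector,
# dual level balls, strong continuity  (part III of three)
-/
import Summits.HodgeConjecture.HodgeCM.PerL34.GenuineSchrodingerHeisModulate

/-!
# The Schwartz–Bruhat space `𝒮(X)` through the adelic Heisenberg group, III: dual level balls,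
# `𝒮(X) = L²(X)^∞`, strong continuity of the Heisenberg orbit maps

`X = Space L = Πʳ_{v split} [(L⁺_v)³, 𝒪_v³]` is the genuine global split Schrödinger space of the
package (`GenuineSchrodingerModel`), `L²(X) = Lp ℂ 2 (μ L)`, `𝒮(X) = Coeff.schwartzBruhat L` the span
of the indicators `1_A` of compact open `A ⊆ X` (pv07-g5 `GenuineSchrodingerSchwartz`; = the locally
constant compactly supported classes, pv13-g5 `GenuineSchrodingerSchwartzDense`), `B_k = levelBall L k`
the compact open level subgroups (pv13-g5 `GenuineSchrodingerRigid`), `τ_y = translate (μ L) y` and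
`M_ξ = modulate (μ L) (heisCharA ψ hψc hψO ξ)` the translations and the adelic Heisenberg modulations
`u ↦ ψ_𝔸(⟨ξ, u⟩) f(u)` (pv13-g5 `GenuineSchrodingerHeisenberg`), for character DATA
`ψ = (ψ_v)_v`, `ψ_v : L⁺_v → U(1)` continuous additive characters with `ψ_v(𝒪_v) = 1` at almost
all `v` (`hψO`).  PROVED HERE, in the kernel and with no further input:

Parts I–II (`GenuineSchrodingerHeisTranslate`, `GenuineSchrodingerHeisModulate`) proved: every `f ∈ 𝒮(X)` is fixed by
`τ(B_k)` and by `M(B_k)` for some `k` (`schwartzBruhat_le_heisSmooth : 𝒮(X) ⊆ L²(X)^∞ = heisSmooth ψ hψc hψO`), the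
converse for compactly supported `τ(B_k)`-fixed classes, the spherical vector, strong continuity of the translations,
compactness of scaled boxes.  Here:

* §7 the DUAL LEVEL BALLS `dualBall ψ hψc hψO k = B_k^⊥ = {u : ψ_𝔸(⟨ξ, u⟩) = 1 ∀ ξ ∈ B_k}` (closed
  subgroups containing `∏_v 𝒪_v³` for `k ≥ k₀`) and `ae_eq_zero_off_dualBall`: a class fixed by `M(B_k)`
  vanishes a.e. off `B_k^⊥` (the RUN-28 step (E2) `proj_eq_self_of_modulate_eq` for the countable
  separating family `ψ_𝔸(⟨ξ_n, ·⟩)`, `ξ_n` a dense sequence of `B_k`); so `schwartzBruhat_eq_heisSmooth`: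
  `𝒮(X) = L²(X)^∞` AS SOON AS the dual balls are compact.
* §8 `continuous_modulate_heisCharA_apply`, `continuous_heisOrbit`: strong continuity of `ξ ↦ M_ξ f`
  and of the joint orbit map `(y, ξ) ↦ M_ξ τ_y f`, `X × X → L²(X)`, for every `f ∈ L²(X)` — the
  Schrödinger representation of the adelic Heisenberg group of `X ⊕ X` on `L²(X)` (pv13-g5: unitary,
  Heisenberg relation `translate_modulate_heisCharA`, irreducible) is a strongly continuous unitary
  representation.
* §9 `isCompact_dualBall`: for data non-trivial at every place (`hψ : ∀ v, ∃ t, ψ_v t ≠ 1`) and of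
  order `0` at almost every place (`hψ1 : ∀ᶠ v, ψ_v t = 1 → ‖t‖ ≤ 1`; with `hψO` this is
  `ψ_v(t) = 1 ↔ t ∈ 𝒪_v` a.e., the standing normalisation of print) every `B_k^⊥` is compact (coordinate
  bounds `‖u_{v,j}‖ ≤ ‖t₀(v)‖ / r_k(v)` at the finitely many exceptional places, `u_v ∈ 𝒪_v³` elsewhere,
  inside a compact box of §4b); hence the headline
  `schwartzBruhat_eq_heisSmooth_of_order_zero : 𝒮(X) = L²(X)^∞` and `mem_schwartzBruhat_of_fixed_of_order_zero`
  (a vector fixed by `τ(B_k)` and `M(B_k)` is Schwartz–Bruhat).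

ABSOLUTE RULE.  Nothing is cited and nothing is posited: every statement is kernel-proved here from the
package's earlier kernel nodes (RUN-28 `LocalFactors.SchrodingerIrreducible`, `SchrodingerLevi`; RUN-30
pv07-g5 `GenuineSchrodingerSchwartz`, pv13-g5 `GenuineSchrodingerRigid` / `…Heisenberg` /
`…SchwartzDense`) and Mathlib.  The only hypotheses are DATA supplied by the caller: the local characters
`ψ`, their continuity `hψc`, almost-everywhere unramifiedness `hψO`, and — in §9 only — everywhere
non-triviality `hψ` and almost-everywhere order `0` `hψ1`.  No PerL / QW8 / 2001-programme statement
appears.  Without a hypothesis of the kind `hψ1` the inclusion `L²(X)^∞ ⊆ 𝒮(X)` is false in general (if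
the conductor of `ψ_v` strictly contains `𝒪_v` at infinitely many places, `B_k^⊥` is not compact and
`∑_n 2^{-n} 1_{u⁽ⁿ⁾ + B_k}` with `u⁽ⁿ⁾ ∈ B_k^⊥` escaping every compact set is smooth but not compactly
supported); §7 isolates exactly what is needed (compact dual balls) and §9 verifies it for order-`0` data.

TREE SHAPE (LEAN-IN-TREE RULE 2026-08-18, `lean/CONVENTIONS.md`: ≤ 400 lines per file).  The material of
this seat's RUN-31 row 1 (891 lines as first handed, md5 a777f951…) is staged as THREE files with byte-identical
declarations: `GenuineSchrodingerHeisTranslate` (§§1–4) → `GenuineSchrodingerHeisModulate` (§§4b–6) →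
`GenuineSchrodingerHeisSmooth` (§§7–9; that module name is kept, so `GenuineSchrodingerHeisAdmissible` /
`GenuineSchrodingerHeisFixedDim` import it unchanged).

Orientation in print (not used as input): the smooth vectors of the Schrödinger representation of a
Heisenberg group over a local field / the adèles form the Schwartz–Bruhat space — A. Weil, *Sur certains
groupes d'opérateurs unitaires*, Acta Math. 111 (1964), Ch. I; C. Mœglin, M.-F. Vignéras,
J.-L. Waldspurger, *Correspondances de Howe sur un corps p-adique*, LNM 1291 (1987), ch. 2, I;
F. Bruhat, *Distributions sur un groupe localement compact et applications à l'étude des représentations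
des groupes p-adiques*, Bull. SMF 89 (1961); restricted products and characters of order `0` at almost
all places: J. Tate, *Fourier analysis in number fields and Hecke's zeta-functions*, in Cassels–Fröhlich,
Algebraic Number Theory (1967).

Namespace `HodgeCM.PerL34.PureTensor.SchrodingerModel.Coeff`; the `ψ`-dependent part is the section
`Characters` with the variables `ψ hψc hψO` of pv13-g5 `GenuineSchrodingerHeisenberg` §2 (same binder
shapes, `hψO` included).
-/

set_option autoImplicit false

noncomputable section

open MeasureTheory MeasureTheory.Measure Set Metric Function Complex Topology Filter
open scoped RestrictedProduct InnerProductSpace NNReal ENNReal Pointwise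

namespace HodgeCM.PerL34.PureTensor.SchrodingerModel

open HodgeCM.PerL34.LocalFactors HodgeCM.PerL34.LocalFactors.DilationModel
open HodgeCM.PerL34.LocalFactors.SchrodingerLevi HodgeCM.PerL34.LocalFactors.SchrodingerIrreducible
open HodgeCM.PerL34.IdelePlaces HodgeCM.PerL34.IdelicTorusModel HodgeCM.PerL34.IdelicTorusModel.Genuine
open NumberField IsDedekindDomain

attribute [local instance] LocalFactors.DilationModel.Adic.nontriviallyNormedField
  LocalFactors.DilationModel.Adic.properSpace

variable {L : Type} [Field L] [NumberField L] [IsCMField L]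

namespace Coeff

/-! ## §7  Modulation-fixed vectors live on the dual ball; `𝒮(X) = L²(X)^∞` when the dual balls are compact -/

section Characters

variable (ψ : ∀ i : SplitIdx L, AddChar ((basePlaceOf L i.1).adicCompletion (maximalRealSubfield L)) Circle)
  (hψc : ∀ i, Continuous (ψ i))
variable (hψO : ∀ᶠ i : SplitIdx L in cofinite,
  ∀ t : (basePlaceOf L i.1).adicCompletion (maximalRealSubfield L), ‖t‖ ≤ 1 → ψ i t = 1)
include hψO

/-- **the dual level ball** `B_k^⊥ = {u ∈ X : ψ_𝔸(⟨ξ, u⟩) = 1 for all ξ ∈ B_k}`, a subgroup of `X` -/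
def dualBall (k : ℕ) : AddSubgroup (Space L) where
  carrier := {u | ∀ ξ ∈ levelBall L k, heisPairing ψ hψc ξ u = 1}
  zero_mem' := fun ξ _ => heisPairing_zero_right ψ hψc ξ
  add_mem' := fun {u v} hu hv ξ hξ => by
    rw [heisPairing_add_right ψ hψc hψO, hu ξ hξ, hv ξ hξ, one_mul]
  neg_mem' := fun {u} hu ξ hξ => by
    have h := heisPairing_add_right ψ hψc hψO ξ u (-u)
    rw [add_neg_cancel, heisPairing_zero_right, hu ξ hξ, one_mul] at h
    exact h.symm

/-- (Ported verbatim from the HodgeCMPerL package; no docstring in the source.) -/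
theorem mem_dualBall_iff {k : ℕ} {u : Space L} :
    u ∈ dualBall ψ hψc hψO k ↔ ∀ ξ ∈ levelBall L k, heisPairing ψ hψc ξ u = 1 :=
  Iff.rfl

/-- the dual level ball is closed -/
theorem isClosed_dualBall (k : ℕ) : IsClosed (dualBall ψ hψc hψO k : Set (Space L)) := by
  have h : (dualBall ψ hψc hψO k : Set (Space L)) =
      ⋂ ξ ∈ (levelBall L k : Set (Space L)), {u | heisPairing ψ hψc ξ u = 1} := by
    ext u
    simp only [SetLike.mem_coe, mem_dualBall_iff, Set.mem_iInter, Set.mem_setOf_eq]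
  rw [h]
  exact isClosed_biInter fun ξ _ => isClosed_eq (continuous_heisPairing ψ hψc hψO ξ) continuous_const

/-- the dual level balls increase with the level -/
theorem dualBall_mono : Monotone (dualBall ψ hψc hψO) :=
  fun _ _ hkj _ hu ξ hξ => hu ξ (levelBall_antitone L hkj hξ)

/-- `∏_v 𝒪_v³ ⊆ B_{k₀}^⊥` for the level `k₀` of uniform unramifiedness; in particular every dual ball of
level `≥ k₀` has non-empty interior -/
theorem exists_box_subset_dualBall : ∃ k₀, (box L : Set (Space L)) ⊆ (dualBall ψ hψc hψO k₀ : Set (Space L)) := by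
  obtain ⟨k₀, hk₀⟩ := exists_level_heisPairing_box_eq_one ψ hψc hψO
  exact ⟨k₀, fun u hu ξ hξ => hk₀ ξ hξ u hu⟩

/-- **modulation-fixed vectors live on the dual ball** ((E2) of the RUN-28 file for the subgroup
`B_k^⊥` and the countable separating family `ψ_𝔸(⟨ξ_n, ·⟩)`, `ξ_n` a dense sequence of `B_k`): if
`M_ξ f = f` for all `ξ ∈ B_k` then `f` vanishes a.e. off `B_k^⊥`. -/
theorem ae_eq_zero_off_dualBall {f : Lp ℂ 2 (μ L)} {k : ℕ}
    (hM : ∀ ξ ∈ levelBall L k, modulate (μ L) (heisCharA ψ hψc hψO ξ) f = f) :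
    ∀ᵐ u ∂(μ L), u ∉ (dualBall ψ hψc hψO k : Set (Space L)) → f u = 0 := by
  classical
  have hK : MeasurableSet (dualBall ψ hψc hψO k : Set (Space L)) := (isClosed_dualBall ψ hψc hψO k).measurableSet
  -- a dense sequence of `X`, projected into `B_k`
  let π : ℕ → Space L := fun n =>
    if TopologicalSpace.denseSeq (Space L) n ∈ levelBall L k then TopologicalSpace.denseSeq (Space L) n else 0
  have hπ : ∀ n, π n ∈ levelBall L k := fun n => by
    simp only [π]
    split_ifs with h
    · exact h
    · exact (levelBall L k).zero_mem
  set 𝓜₀ : Set C(Space L, Circle) := Set.range fun n => heisCharA ψ hψc hψO (π n) with h𝓜₀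
  have hsep : ∀ u, u ∉ dualBall ψ hψc hψO k →
      ∃ χ ∈ 𝓜₀, (∀ t ∈ dualBall ψ hψc hψO k, χ t = 1) ∧ χ u ≠ 1 := by
    intro u hu
    rw [mem_dualBall_iff] at hu
    push Not at hu
    obtain ⟨ξ, hξ, hξu⟩ := hu
    -- the open set `{ξ' ∈ B_k : ψ_𝔸(⟨ξ', u⟩) ≠ 1}` is non-empty, so it contains a term of the dense sequence
    have hopen : IsOpen ((levelBall L k : Set (Space L)) ∩ {ξ' | heisPairing ψ hψc ξ' u ≠ 1}) := by
      refine (isOpen_levelBall L k).inter ?_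
      have hc : Continuous fun ξ' : Space L => heisPairing ψ hψc ξ' u := by
        have h := continuous_heisPairing ψ hψc hψO u
        refine h.congr fun ξ' => heisPairing_comm ψ hψc u ξ'
      exact isOpen_compl_singleton.preimage hc
    obtain ⟨n, hn⟩ := (TopologicalSpace.denseRange_denseSeq (Space L)).exists_mem_open hopen ⟨ξ, hξ, hξu⟩
    have hπn : π n = TopologicalSpace.denseSeq (Space L) n :=
      if_pos (show TopologicalSpace.denseSeq (Space L) n ∈ levelBall L k from hn.1)
    refine ⟨heisCharA ψ hψc hψO (π n), ⟨n, rfl⟩, fun t ht => ht (π n) (hπ n), ?_⟩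
    rw [heisCharA_apply, hπn]
    exact hn.2
  have hf : ∀ χ ∈ 𝓜₀, (∀ t ∈ dualBall ψ hψc hψO k, χ t = 1) → modulate (μ L) χ f = f := by
    rintro _ ⟨n, rfl⟩ -
    exact hM (π n) (hπ n)
  exact (proj_eq_self_iff (μ L) hK f).1
    (proj_eq_self_of_modulate_eq (μ L) (dualBall ψ hψc hψO k) hK 𝓜₀ (Set.countable_range _) hsep f hf)

/-- **smooth vectors are Schwartz–Bruhat as soon as the dual balls are compact**: if `B_k^⊥` is compact
for every `k` (a property of the character data `ψ` alone — it says that `ψ_v` has order `0` at almost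
all places), then `L²(X)^∞ ⊆ 𝒮(X)`. -/
theorem heisSmooth_le_schwartzBruhat (hcpt : ∀ k, IsCompact (dualBall ψ hψc hψO k : Set (Space L))) :
    heisSmooth ψ hψc hψO ≤ schwartzBruhat L := by
  rintro f ⟨k, hk, hkM⟩
  exact mem_schwartzBruhat_of_translate_eq hk (hcpt k) (ae_eq_zero_off_dualBall ψ hψc hψO hkM)

/-- **`𝒮(X) = L²(X)^∞`** for character data with compact dual balls. -/
theorem schwartzBruhat_eq_heisSmooth (hcpt : ∀ k, IsCompact (dualBall ψ hψc hψO k : Set (Space L))) :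
    schwartzBruhat L = heisSmooth ψ hψc hψO :=
  le_antisymm (schwartzBruhat_le_heisSmooth ψ hψc hψO) (heisSmooth_le_schwartzBruhat ψ hψc hψO hcpt)

/-- the level-`k` FIXED SPACE for compact dual balls: a vector fixed by `τ(B_k)` and `M(B_k)` is a
(finite) linear combination of indicators of level-`k` cosets inside `B_k^⊥` — in particular it lies in
`𝒮(X)`. -/
theorem mem_schwartzBruhat_of_fixed {f : Lp ℂ 2 (μ L)} {k : ℕ}
    (hcpt : IsCompact (dualBall ψ hψc hψO k : Set (Space L)))
    (hk : ∀ y ∈ levelBall L k, translate (μ L) y f = f)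
    (hkM : ∀ ξ ∈ levelBall L k, modulate (μ L) (heisCharA ψ hψc hψO ξ) f = f) : f ∈ schwartzBruhat L :=
  mem_schwartzBruhat_of_translate_eq hk hcpt (ae_eq_zero_off_dualBall ψ hψc hψO hkM)

/-! ## §8  Strong continuity of the modulations and of the Heisenberg–Schrödinger orbit maps -/

/-- `M_ξ = M_{ξ - ξ₀} M_{ξ₀}` -/
theorem modulate_heisCharA_split (ξ ξ₀ : Space L) (f : Lp ℂ 2 (μ L)) :
    modulate (μ L) (heisCharA ψ hψc hψO ξ) f =
      modulate (μ L) (heisCharA ψ hψc hψO (ξ - ξ₀)) (modulate (μ L) (heisCharA ψ hψc hψO ξ₀) f) := by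
  have h := congrArg (fun T : Lp ℂ 2 (μ L) ≃ₗᵢ[ℂ] Lp ℂ 2 (μ L) => T f)
    (modulate_mul_modulate (μ L) (heisCharA ψ hψc hψO (ξ - ξ₀)) (heisCharA ψ hψc hψO ξ₀))
  simp only [LinearIsometryEquiv.coe_mul, Function.comp_apply] at h
  rw [h, ← heisCharA_add, sub_add_cancel]

/-- **strong continuity of `ξ ↦ M_ξ` on `L²(X)`**: for every `f`, `ξ ↦ M_{ψ_𝔸(⟨ξ,·⟩)} f` is continuous. -/
theorem continuous_modulate_heisCharA_apply (f : Lp ℂ 2 (μ L)) :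
    Continuous fun ξ : Space L => modulate (μ L) (heisCharA ψ hψc hψO ξ) f := by
  rw [continuous_iff_continuousAt]
  intro ξ₀
  rw [ContinuousAt, Metric.tendsto_nhds]
  intro ε hε
  obtain ⟨s, hs, hfs⟩ := (dense_schwartzBruhat (L := L)).exists_dist_lt
    (modulate (μ L) (heisCharA ψ hψc hψO ξ₀) f) (half_pos hε)
  obtain ⟨k, hk⟩ := exists_level_modulate_eq ψ hψc hψO hs
  have hnhd : (fun ξ : Space L => ξ - ξ₀) ⁻¹' (levelBall L k : Set (Space L)) ∈ 𝓝 ξ₀ :=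
    (continuous_sub_right ξ₀).continuousAt.preimage_mem_nhds
      (by simpa only [sub_self] using (isOpen_levelBall L k).mem_nhds (levelBall L k).zero_mem)
  filter_upwards [hnhd] with ξ hξ
  rw [Set.mem_preimage, SetLike.mem_coe] at hξ
  rw [modulate_heisCharA_split ψ hψc hψO ξ ξ₀ f, dist_eq_norm]
  set g := modulate (μ L) (heisCharA ψ hψc hψO ξ₀) f with hg
  have heq : modulate (μ L) (heisCharA ψ hψc hψO (ξ - ξ₀)) g - g =
      modulate (μ L) (heisCharA ψ hψc hψO (ξ - ξ₀)) (g - s) - (g - s) := by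
    rw [map_sub, hk _ hξ]
    abel
  rw [heq]
  rw [dist_eq_norm] at hfs
  calc ‖modulate (μ L) (heisCharA ψ hψc hψO (ξ - ξ₀)) (g - s) - (g - s)‖
      ≤ ‖modulate (μ L) (heisCharA ψ hψc hψO (ξ - ξ₀)) (g - s)‖ + ‖g - s‖ := norm_sub_le _ _
    _ = ‖g - s‖ + ‖g - s‖ := by rw [LinearIsometryEquiv.norm_map]
    _ < ε / 2 + ε / 2 := add_lt_add hfs hfs
    _ = ε := add_halves ε

/-- **strong continuity of the Schrödinger representation of the adelic Heisenberg group**: for every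
`f ∈ L²(X)` the orbit map `(y, ξ) ↦ M_ξ τ_y f`, `X × X → L²(X)`, is continuous. -/
theorem continuous_heisOrbit (f : Lp ℂ 2 (μ L)) :
    Continuous fun p : Space L × Space L =>
      modulate (μ L) (heisCharA ψ hψc hψO p.2) (translate (μ L) p.1 f) := by
  rw [continuous_iff_continuousAt]
  rintro ⟨y₀, ξ₀⟩
  set g := translate (μ L) y₀ f with hg
  have h1 : Tendsto (fun p : Space L × Space L => ‖translate (μ L) p.1 f - g‖) (𝓝 (y₀, ξ₀)) (𝓝 0) := by
    have h := ((continuous_translate_apply f).tendsto y₀).comp (continuous_fst.tendsto (y₀, ξ₀))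
    rw [tendsto_iff_norm_sub_tendsto_zero] at h
    exact h
  have h2 : Tendsto (fun p : Space L × Space L =>
      ‖modulate (μ L) (heisCharA ψ hψc hψO p.2) g - modulate (μ L) (heisCharA ψ hψc hψO ξ₀) g‖)
      (𝓝 (y₀, ξ₀)) (𝓝 0) := by
    have h := ((continuous_modulate_heisCharA_apply ψ hψc hψO g).tendsto ξ₀).comp
      (continuous_snd.tendsto (y₀, ξ₀))
    rw [tendsto_iff_norm_sub_tendsto_zero] at h
    exact h
  rw [ContinuousAt, tendsto_iff_norm_sub_tendsto_zero]
  refine squeeze_zero (fun _ => norm_nonneg _) (fun p => ?_) (by simpa using h1.add h2)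
  calc ‖modulate (μ L) (heisCharA ψ hψc hψO p.2) (translate (μ L) p.1 f) -
        modulate (μ L) (heisCharA ψ hψc hψO ξ₀) g‖
      = ‖modulate (μ L) (heisCharA ψ hψc hψO p.2) (translate (μ L) p.1 f - g) +
          (modulate (μ L) (heisCharA ψ hψc hψO p.2) g - modulate (μ L) (heisCharA ψ hψc hψO ξ₀) g)‖ := by
        rw [map_sub]
        congr 1
        abel
    _ ≤ ‖modulate (μ L) (heisCharA ψ hψc hψO p.2) (translate (μ L) p.1 f - g)‖ +
          ‖modulate (μ L) (heisCharA ψ hψc hψO p.2) g - modulate (μ L) (heisCharA ψ hψc hψO ξ₀) g‖ :=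
        norm_add_le _ _
    _ = ‖translate (μ L) p.1 f - g‖ +
          ‖modulate (μ L) (heisCharA ψ hψc hψO p.2) g - modulate (μ L) (heisCharA ψ hψc hψO ξ₀) g‖ := by
        rw [LinearIsometryEquiv.norm_map]

/-! ## §9  Compact dual balls for everywhere non-trivial data of order `0` at almost all places;
`𝒮(X) = L²(X)^∞` -/

/-- duality tested on one coordinate: for `u ∈ B_k^⊥` and `‖s‖ ≤ r_k(v)`, `ψ_v(s · u_{v,j}) = 1` -/
theorem apply_mul_eq_one_of_mem_dualBall {k : ℕ} {u : Space L} (hu : u ∈ dualBall ψ hψc hψO k)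
    (i : SplitIdx L) (j : Fin 3) {s : (basePlaceOf L i.1).adicCompletion (maximalRealSubfield L)}
    (hs : ‖s‖ ≤ rad L k i) : ψ i (s * u i j) = 1 := by
  classical
  have hmem : singleAt i (Pi.single j s) ∈ levelBall L k := by
    rw [mem_levelBall_iff]
    intro i'
    by_cases h : i' = i
    · subst h
      rw [singleAt_apply_self, Pi.norm_single]
      exact hs
    · rw [singleAt_apply_of_ne h, norm_zero]
      exact (rad_pos L k i').le
  have h : heisCharA ψ hψc hψO (singleAt i (Pi.single j s)) u = 1 := hu _ hmem
  rwa [heisCharA_singleAt, adelicCoordChar_apply] at h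

/-- the coordinate bound at an arbitrary place: if `ψ_v(t₀) ≠ 1` then `‖u_{v,j}‖ ≤ ‖t₀‖ / r_k(v)` on `B_k^⊥` -/
theorem norm_apply_le_of_mem_dualBall {k : ℕ} {u : Space L} (hu : u ∈ dualBall ψ hψc hψO k)
    (i : SplitIdx L) (j : Fin 3) {t₀ : (basePlaceOf L i.1).adicCompletion (maximalRealSubfield L)}
    (ht₀ : ψ i t₀ ≠ 1) : ‖u i j‖ ≤ ‖t₀‖ / rad L k i := by
  by_contra H
  rw [not_le] at H
  have hr := rad_pos L k i
  have hupos : 0 < ‖u i j‖ := lt_of_le_of_lt (div_nonneg (norm_nonneg _) hr.le) H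
  have hu0 : u i j ≠ 0 := norm_pos_iff.1 hupos
  have hs : ‖t₀ / u i j‖ ≤ rad L k i := by
    rw [norm_div, div_le_iff₀ hupos]
    rw [div_lt_iff₀ hr, mul_comm] at H
    exact H.le
  have h := apply_mul_eq_one_of_mem_dualBall ψ hψc hψO hu i j hs
  rw [div_mul_cancel₀ t₀ hu0] at h
  exact ht₀ h

/-- the coordinate bound at a place of order `0` outside the first `k`: `u_v ∈ 𝒪_v³` on `B_k^⊥` -/
theorem norm_apply_le_one_of_mem_dualBall {k : ℕ} {u : Space L} (hu : u ∈ dualBall ψ hψc hψO k)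
    {i : SplitIdx L} (hψ1 : ∀ t, ψ i t = 1 → ‖t‖ ≤ 1) (hik : ¬ enumIdx L i < k) : ‖u i‖ ≤ 1 := by
  refine (pi_norm_le_iff_of_nonneg zero_le_one).2 fun j => ?_
  have h := apply_mul_eq_one_of_mem_dualBall ψ hψc hψO hu i j
    (s := 1) (by rw [norm_one, rad_of_not_lt hik])
  rw [one_mul] at h
  exact hψ1 _ h

/-- **the dual balls are compact** for character data `ψ = (ψ_v)` that is non-trivial at every place and
of order `0` (`ψ_v(t) = 1 ↔ ‖t‖ ≤ 1`) at almost every place — the standing normalisation of print. -/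
theorem isCompact_dualBall (hψ : ∀ i, ∃ t, ψ i t ≠ 1)
    (hψ1 : ∀ᶠ i : SplitIdx L in cofinite, ∀ t, ψ i t = 1 → ‖t‖ ≤ 1) (k : ℕ) :
    IsCompact (dualBall ψ hψc hψO k : Set (Space L)) := by
  classical
  -- the finite exceptional set: places not of order `0`, and the first `k` places
  set S : Set (SplitIdx L) := {i | ¬ ∀ t, ψ i t = 1 → ‖t‖ ≤ 1} ∪ {i | enumIdx L i < k} with hS
  have hSf : S.Finite := (Filter.eventually_cofinite.1 hψ1).union (finite_enumIdx_lt L k)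
  -- radii: `1` off `S`, `‖t₀(v)‖ / r_k(v)` on `S`
  let t₀ : ∀ i : SplitIdx L, (basePlaceOf L i.1).adicCompletion (maximalRealSubfield L) :=
    fun i => Classical.choose (hψ i)
  have ht₀ : ∀ i, ψ i (t₀ i) ≠ 1 := fun i => Classical.choose_spec (hψ i)
  let R : SplitIdx L → ℝ := fun i => if i ∈ S then max (‖t₀ i‖ / rad L k i) 1 else 1
  have hR : ∀ i ∉ S, R i = 1 := fun i hi => if_neg hi
  refine (isCompact_setOf_forall_norm_le hSf R hR).of_isClosed_subset (isClosed_dualBall ψ hψc hψO k)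
    fun u hu i => ?_
  by_cases hi : i ∈ S
  · simp only [R, if_pos hi]
    refine (pi_norm_le_iff_of_nonneg ((zero_le_one).trans (le_max_right _ _))).2 fun j => ?_
    exact (norm_apply_le_of_mem_dualBall ψ hψc hψO hu i j (ht₀ i)).trans (le_max_left _ _)
  · simp only [R, if_neg hi]
    rw [hS, Set.mem_union, not_or, Set.mem_setOf_eq, Set.mem_setOf_eq, not_not] at hi
    exact norm_apply_le_one_of_mem_dualBall ψ hψc hψO hu hi.1 hi.2

/-- **`𝒮(X) = L²(X)^∞` for everywhere non-trivial character data of order `0` at almost all places**: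
the Schwartz–Bruhat space is exactly the space of smooth vectors of the Schrödinger representation of
the adelic Heisenberg group on `L²(X)`. -/
theorem schwartzBruhat_eq_heisSmooth_of_order_zero (hψ : ∀ i, ∃ t, ψ i t ≠ 1)
    (hψ1 : ∀ᶠ i : SplitIdx L in cofinite, ∀ t, ψ i t = 1 → ‖t‖ ≤ 1) :
    schwartzBruhat L = heisSmooth ψ hψc hψO :=
  schwartzBruhat_eq_heisSmooth ψ hψc hψO (isCompact_dualBall ψ hψc hψO hψ hψ1)

/-- in particular a vector fixed by `τ(B_k)` and `M(B_k)` is Schwartz–Bruhat (order-`0` data) -/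
theorem mem_schwartzBruhat_of_fixed_of_order_zero (hψ : ∀ i, ∃ t, ψ i t ≠ 1)
    (hψ1 : ∀ᶠ i : SplitIdx L in cofinite, ∀ t, ψ i t = 1 → ‖t‖ ≤ 1) {f : Lp ℂ 2 (μ L)} {k : ℕ}
    (hk : ∀ y ∈ levelBall L k, translate (μ L) y f = f)
    (hkM : ∀ ξ ∈ levelBall L k, modulate (μ L) (heisCharA ψ hψc hψO ξ) f = f) : f ∈ schwartzBruhat L :=
  mem_schwartzBruhat_of_fixed ψ hψc hψO (isCompact_dualBall ψ hψc hψO hψ hψ1 k) hk hkM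

end Characters

end Coeff

end HodgeCM.PerL34.PureTensor.SchrodingerModel
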